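import Summits.Ventures.LatticeQCDFlow.Exactness.AdjointKernels
import Literature.Probability.MarkovChains.DoeblinMinorization
import HarnessLib

/-!
# Minorisation algebra for update cycles, and the forgetful refresh scan on a product space

HONEST FRAMING: exact (Metropolis-corrected) sampling algorithms for lattice gauge theory;
figures of merit are autocorrelation/cost numbers at stated couplings and volumes; no
continuum-physics claim.

Venture `LatticeQCDFlow` (cell pub-lqcd), topic `Exactness`, FANOUT row 9 (eng-latcore, the
engine `latflow.core`).  NEW WORK of the cell over Mathlib's Markov-kernel library, the marginal
integral `∫⋯∫⁻_s, f ∂μ` (`MeasureTheory.lmarginal`), the tree's update cycles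
(`Exactness/InvariantComposition.lean`, `Exactness/AdjointKernels.lean`: `cycle`,
`isMarkovKernel_cycle`) and the tree's formalisation of Doeblin's theorem
(`Literature.Probability.MarkovChains.Doeblin.doeblin_iterate_sub_invariant_le`, Meyn–Tweedie 1993
Thm 16.2.4).  Nothing here is cited as a fact.  Printed counterparts, NAMED ONLY: Meyn–Tweedie 1993
Thm 16.0.2 / 16.2.4 (small sets, uniform ergodicity); Roberts–Rosenthal 2004 (Probab. Surveys 1,
§3.3: minorisation conditions and how they propagate).  This file is the state-space-free half of
the heat-bath ergodicity argument; `Exactness/HeatBathSweepErgodic.lean` applies it to the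
engine's single-site heat-bath sweep.

## What is proved

* §1 (any measurable space).  Minorisations of Mathlib kernels, stated as `ε • Φ a ≤ κ a`
  (measures, from every state `a`): they COMPOSE (`comp_minorised`: `κ ≥ εΦ`, `κ' ≥ ε'Φ'` ⇒
  `κ' ∘ₖ κ ≥ εε' (Φ' ∘ₖ Φ)`; `cycle_minorised` for update cycles, constant `ε ^ length`), a
  constant minorant survives post- and pre-composition with ANY (Markov) kernel
  (`minorised_comp_left` / `minorised_comp_right`: the minorising law `ν` becomes `νη` / stays
  `ν`), invariance is homogeneous (`invariant_smul`), and a constant minorant `ε • ν ≤ κ a` by a probability law plus an invariant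
  probability law gives **`uniformlyErgodic_of_minorised`**: `|μ₀κᵗ(A) − π(A)| ≤ (1 − ε)ᵗ` for
  every initial law `μ₀`, every `t`, every set `A` (`ε ≤ 1` is automatic) — the bridge to the
  Literature theorem.
* §2 (configurations `Π_{i ∈ ι} X_i`, `ι` with decidable equality, laws `μ_i`).  `siteLift i κ`
  overwrites coordinate `i` with a draw from an `X_i`-valued law `κ ω` that may read the whole
  configuration (`siteLift_apply`: `(κ ω).map (update ω i)`, `lintegral_siteLift`); the FREE
  REFRESH `refresh μ i` (redraw `ω_i ∼ μ_i`) integrates as the one-site marginal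
  (`lintegral_refresh`); marginalising an already-marginalised site is absorbed
  (`lmarginal_absorb`, probability laws); a cycle of refreshes over a list `l` of sites integrates
  as `∫⋯∫⁻_{l.toFinset}` in any order and with repetitions (`lintegral_cycle_refresh`); for finite
  `ι`, **a refresh scan visiting every site forgets the start**:
  `cycle (l.map (refresh μ)) = Kernel.const _ (Measure.pi μ)` (`cycle_refresh_eq_const`), and the
  tower property `∫ (∫⋯∫⁻_{i} g) d⊗μ = ∫ g d⊗μ` (`lintegral_pi_lmarginal`).

NOT CLAIMED here: anything about a target density (that is `HeatBathSweepErgodic.lean`);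
quantitative rates beyond the Doeblin constant.
-/

namespace Summit.Ventures.LatticeQCDFlow.Exactness

open MeasureTheory ProbabilityTheory Function
open scoped ENNReal

/-! ## §1 Minorisation algebra on a general state space -/

section Minorisation

variable {α : Type*} [MeasurableSpace α]

/-- **Minorisations compose.**  If `κ a ≥ ε Φ a` and `κ' a ≥ ε' Φ' a` from every state (as
measures), then `(κ' ∘ₖ κ) a ≥ (ε ε') (Φ' ∘ₖ Φ) a` from every state. -/
theorem comp_minorised {κ κ' Φ Φ' : Kernel α α} {ε ε' : ℝ≥0∞}
    (h : ∀ a, ε • Φ a ≤ κ a) (h' : ∀ a, ε' • Φ' a ≤ κ' a) (a : α) :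
    (ε * ε') • (Φ' ∘ₖ Φ) a ≤ (κ' ∘ₖ κ) a := by
  refine Measure.le_iff.2 fun s hs => ?_
  rw [Measure.smul_apply, smul_eq_mul, Kernel.comp_apply' _ _ _ hs, Kernel.comp_apply' _ _ _ hs]
  calc ε * ε' * ∫⁻ b, Φ' b s ∂Φ a = ∫⁻ b, ε' * Φ' b s ∂(ε • Φ a) := by
        rw [lintegral_smul_measure, smul_eq_mul, lintegral_const_mul _ (Kernel.measurable_coe Φ' hs),
          mul_assoc]
    _ ≤ ∫⁻ b, κ' b s ∂κ a := lintegral_mono' (h a) fun b => by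
        have hb := Measure.le_iff.1 (h' b) s hs
        rwa [Measure.smul_apply, smul_eq_mul] at hb

/-- The identity kernel minorises itself with constant `1` (base case of cycles). -/
theorem minorised_refl (κ : Kernel α α) (a : α) : (1 : ℝ≥0∞) • κ a ≤ κ a := by
  rw [one_smul]

/-- **Minorisations survive update cycles**: if the members of `ks` dominate `ε ×` the
corresponding members of `Φs`, statewise, then `cycle ks a ≥ ε ^ |ks| • cycle Φs a`. -/
theorem cycle_minorised {ε : ℝ≥0∞} :
    ∀ {ks Φs : List (Kernel α α)}, List.Forall₂ (fun κ Φ => ∀ a, ε • Φ a ≤ κ a) ks Φs →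
      ∀ a, ε ^ ks.length • cycle Φs a ≤ cycle ks a
  | _, _, List.Forall₂.nil => fun a => by
      rw [List.length_nil, pow_zero, one_smul]
  | _, _, List.Forall₂.cons (a := κ) (b := Φ) (l₁ := ks) (l₂ := Φs) hκ hrest => fun a => by
      rw [cycle_cons, cycle_cons, List.length_cons, pow_succ]
      exact comp_minorised (cycle_minorised hrest) hκ a

/-- A constant minorant survives POST-composition with any kernel: if `κ a ≥ ε ν` for all `a`, then
`(η ∘ₖ κ) a ≥ ε (νη)` for all `a`. -/
theorem minorised_comp_left {κ : Kernel α α} {ν : Measure α} {ε : ℝ≥0∞}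
    (h : ∀ a, ε • ν ≤ κ a) (η : Kernel α α) (a : α) : ε • ν.bind η ≤ (η ∘ₖ κ) a := by
  refine Measure.le_iff.2 fun s hs => ?_
  rw [Measure.smul_apply, smul_eq_mul, Kernel.comp_apply' _ _ _ hs,
    Measure.bind_apply hs (Kernel.aemeasurable η)]
  calc ε * ∫⁻ b, η b s ∂ν = ∫⁻ b, η b s ∂(ε • ν) := by rw [lintegral_smul_measure, smul_eq_mul]
    _ ≤ ∫⁻ b, η b s ∂κ a := lintegral_mono' (h a) le_rfl

/-- A constant minorant survives PRE-composition with any Markov kernel: if `κ a ≥ ε ν` for all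
`a`, then `(κ ∘ₖ η) a ≥ ε ν` for all `a`. -/
theorem minorised_comp_right {κ : Kernel α α} {ν : Measure α} {ε : ℝ≥0∞}
    (h : ∀ a, ε • ν ≤ κ a) (η : Kernel α α) [IsMarkovKernel η] (a : α) :
    ε • ν ≤ (κ ∘ₖ η) a := by
  refine Measure.le_iff.2 fun s hs => ?_
  rw [Measure.smul_apply, smul_eq_mul, Kernel.comp_apply' _ _ _ hs]
  calc ε * ν s = ∫⁻ _, ε * ν s ∂η a := by rw [lintegral_const, measure_univ, mul_one]
    _ ≤ ∫⁻ b, κ b s ∂η a := lintegral_mono fun b => by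
        have hb := Measure.le_iff.1 (h b) s hs
        rwa [Measure.smul_apply, smul_eq_mul] at hb

/-- Invariance is homogeneous in the measure (normalising an invariant weight keeps it invariant). -/
theorem invariant_smul {κ : Kernel α α} {μ : Measure α} (h : Kernel.Invariant κ μ) (c : ℝ≥0∞) :
    Kernel.Invariant κ (c • μ) := by
  change (c • μ).bind κ = c • μ
  rw [Measure.bind_smul, h.def]

/-- **Uniform ergodicity from a constant minorant** (the bridge to Doeblin's theorem in the tree):
if a Markov kernel satisfies `κ a ≥ ε ν` from every state for a probability law `ν`, and `π` is an
invariant probability law, then for every initial law `μ₀`, every `t` and every set `A`,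
`|μ₀κᵗ(A) − π(A)| ≤ (1 − ε)ᵗ` (`ε ≤ 1` holds automatically). -/
theorem uniformlyErgodic_of_minorised {κ : Kernel α α} [IsMarkovKernel κ] {ν : Measure α}
    [IsProbabilityMeasure ν] {ε : ℝ≥0∞} (h : ∀ a, ε • ν ≤ κ a) {π : Measure α}
    [IsProbabilityMeasure π] (hπ : Kernel.Invariant κ π) (μ₀ : Measure α) [IsProbabilityMeasure μ₀]
    (t : ℕ) (A : Set α) :
    |((fun m : Measure α => m.bind κ)^[t] μ₀).real A - π.real A| ≤ (1 - ε.toReal) ^ t := by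
  obtain ⟨a⟩ := nonempty_of_isProbabilityMeasure π
  have hmin : ∀ x {B : Set α}, MeasurableSet B → ε * ν B ≤ κ x B := fun x B hB => by
    have hx := Measure.le_iff.1 (h x) B hB
    rwa [Measure.smul_apply, smul_eq_mul] at hx
  have hε1 : ε ≤ 1 := by
    have h1 := hmin a MeasurableSet.univ
    rwa [measure_univ, measure_univ, mul_one] at h1
  exact Literature.Probability.MarkovChains.Doeblin.doeblin_iterate_sub_invariant_le hmin hε1 hπ μ₀ t A

end Minorisation

/-! ## §2 Configurations on a finite product: overwriting one site, the free refresh, forgetful scans -/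

section Product

variable {ι : Type*} [DecidableEq ι] {X : ι → Type*} [∀ i, MeasurableSpace (X i)]

/-- Overwrite coordinate `i` of the configuration with a draw from the `X i`-valued law `κ ω`
(which may read the whole configuration `ω`), keeping every other coordinate. -/
noncomputable def siteLift (i : ι) (κ : Kernel (Π j, X j) (X i)) : Kernel (Π j, X j) (Π j, X j) :=
  Kernel.map (Kernel.id ×ₖ κ) (fun q : (Π j, X j) × X i => update q.1 i q.2)

/-- `siteLift i κ ω` is the image of `κ ω` under `ξ ↦ ω|ω_i := ξ`. -/
theorem siteLift_apply (i : ι) (κ : Kernel (Π j, X j) (X i)) [IsSFiniteKernel κ] (ω : Π j, X j) :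
    siteLift i κ ω = (κ ω).map (update ω i) := by
  ext s hs
  rw [siteLift, Kernel.map_apply' _ measurable_update' _ hs,
    Kernel.id_prod_apply' _ _ (measurable_update' hs), Measure.map_apply (measurable_update ω) hs]
  rfl

/-- Integrating against a lifted site update. -/
theorem lintegral_siteLift (i : ι) (κ : Kernel (Π j, X j) (X i)) [IsSFiniteKernel κ]
    (ω : Π j, X j) {g : (Π j, X j) → ℝ≥0∞} (hg : Measurable g) :
    ∫⁻ ω', g ω' ∂(siteLift i κ ω) = ∫⁻ ξ, g (update ω i ξ) ∂(κ ω) := by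
  rw [siteLift_apply, lintegral_map hg (measurable_update ω)]

/-- A lifted Markov update is Markov. -/
instance isMarkovKernel_siteLift (i : ι) (κ : Kernel (Π j, X j) (X i)) [IsMarkovKernel κ] :
    IsMarkovKernel (siteLift i κ) :=
  Kernel.IsMarkovKernel.map _ measurable_update'

variable (μ : Π i, Measure (X i))

/-- The FREE REFRESH of site `i`: redraw `ω_i ∼ μ_i` independently of everything. -/
noncomputable def refresh (i : ι) : Kernel (Π j, X j) (Π j, X j) :=
  siteLift i (Kernel.const _ (μ i))

variable {μ}

/-- The free refresh is Markov for probability laws `μ_i`. -/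
instance isMarkovKernel_refresh [∀ i, IsProbabilityMeasure (μ i)] (i : ι) :
    IsMarkovKernel (refresh μ i) := by
  unfold refresh; infer_instance

/-- Integrating against the free refresh of site `i` is the one-site marginal integral. -/
theorem lintegral_refresh [∀ i, SFinite (μ i)] (i : ι) (ω : Π j, X j)
    {g : (Π j, X j) → ℝ≥0∞} (hg : Measurable g) :
    ∫⁻ ω', g ω' ∂(refresh μ i ω) = (∫⋯∫⁻_{i}, g ∂μ) ω := by
  rw [lmarginal_singleton, refresh, lintegral_siteLift _ _ _ hg, Kernel.const_apply]

/-- Marginalising a site that is already marginalised changes nothing (probability laws). -/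
theorem lmarginal_absorb [∀ i, IsProbabilityMeasure (μ i)] {s : Finset ι} {i : ι} (hi : i ∈ s)
    {g : (Π j, X j) → ℝ≥0∞} (hg : Measurable g) :
    ∫⋯∫⁻_s, ∫⋯∫⁻_{i}, g ∂μ ∂μ = ∫⋯∫⁻_s, g ∂μ := by
  rw [lmarginal_erase' _ (hg.lmarginal μ) hi, lmarginal_erase' g hg hi]
  congr 1
  funext x
  have hconst : ∀ xᵢ, (∫⋯∫⁻_{i}, g ∂μ) (update x i xᵢ) = (∫⋯∫⁻_{i}, g ∂μ) x := fun xᵢ =>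
    lmarginal_update_of_mem μ (Finset.mem_singleton_self i) g x xᵢ
  simp_rw [hconst]
  rw [lintegral_const, measure_univ, mul_one, lmarginal_singleton]

/-- **A cycle of free refreshes integrates as the marginal over the visited sites** (in any order,
with repetitions). -/
theorem lintegral_cycle_refresh [∀ i, IsProbabilityMeasure (μ i)] :
    ∀ (l : List ι) (ω : Π j, X j) {g : (Π j, X j) → ℝ≥0∞}, Measurable g →
      ∫⁻ ω', g ω' ∂(cycle (l.map (refresh μ)) ω) = (∫⋯∫⁻_l.toFinset, g ∂μ) ω
  | [], ω, g, hg => by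
      rw [List.map_nil, cycle_nil, Kernel.id_apply, lintegral_dirac' _ hg, List.toFinset_nil,
        lmarginal_empty]
  | i :: l, ω, g, hg => by
      rw [List.map_cons, cycle_cons, Kernel.lintegral_comp _ _ _ hg]
      have hinner : ∀ ω', ∫⁻ ω'', g ω'' ∂(refresh μ i ω') = (∫⋯∫⁻_{i}, g ∂μ) ω' := fun ω' =>
        lintegral_refresh i ω' hg
      simp_rw [hinner]
      rw [lintegral_cycle_refresh l ω (hg.lmarginal μ), List.toFinset_cons]
      by_cases hil : i ∈ l.toFinset
      · rw [Finset.insert_eq_of_mem hil, lmarginal_absorb hil hg]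
      · rw [lmarginal_insert' g hg hil, lmarginal_singleton]

variable [Fintype ι]

/-- **A refresh scan visiting every site forgets the start**: it is the constant kernel `⊗μ_i`. -/
theorem cycle_refresh_eq_const [∀ i, IsProbabilityMeasure (μ i)] {l : List ι} (hl : ∀ i, i ∈ l) :
    cycle (l.map (refresh μ)) = Kernel.const (Π j, X j) (Measure.pi μ) := by
  have huniv : l.toFinset = Finset.univ :=
    Finset.eq_univ_iff_forall.2 fun i => List.mem_toFinset.2 (hl i)
  ext ω s hs
  rw [Kernel.const_apply, ← lintegral_indicator_one hs,
    lintegral_cycle_refresh l ω (measurable_one.indicator hs), huniv, lmarginal_univ,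
    lintegral_indicator_one hs]

/-- Tower property: integrating a one-site marginal against the product law is integrating the
function itself. -/
theorem lintegral_pi_lmarginal [∀ i, IsProbabilityMeasure (μ i)] (i : ι)
    {g : (Π j, X j) → ℝ≥0∞} (hg : Measurable g) :
    ∫⁻ ω, (∫⋯∫⁻_{i}, g ∂μ) ω ∂Measure.pi μ = ∫⁻ ω, g ω ∂Measure.pi μ := by
  rcases isEmpty_or_nonempty (Π j, X j) with hE | ⟨⟨ω₀⟩⟩
  · rw [Measure.eq_zero_of_isEmpty (Measure.pi μ), lintegral_zero_measure, lintegral_zero_measure]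
  · rw [lintegral_eq_lmarginal_univ ω₀, lintegral_eq_lmarginal_univ ω₀,
      lmarginal_absorb (Finset.mem_univ i) hg]

end Product

end Summit.Ventures.LatticeQCDFlow.Exactness
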